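import Literature.AnabelianGeometry.SemiGraphs.GraphCoveringObject
import Literature.AnabelianGeometry.SemiGraphs.CyclicCovering
import Literature.AnabelianGeometry.Anabelioids.TrivialObjectSections

/-!
# Sections of a graph-covering over `𝕂` and the trivial action of `Π_𝕂` ([SemiAnbd] Prop. 2.6, p. 29)

Mochizuki, *Semi-graphs of anabelioids*, Publ. RIMS **42** (2006) 221–322, §2, proof of
Proposition 2.6 (edge case), p. 29 [cite: MochizukiSemiAnbd2006, Prop. 2.6 p.29]: the finite
graph-covering `𝔾′ → 𝔾` "is trivial over `𝕂`", so that `Π_𝕂` acts trivially on the corresponding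
finite `Π_𝒢`-set.  This file proves the mechanism:

* `autApp_map_ι_eq_of_section`: a section `s : 𝕂 → 𝔾′` of `ψ` over a sub-semi-graph `𝕂`
  gives, for every vertex `w` of `𝕂`, a point of the fibre of `coveringObj ψ` at `w` (the sheet
  `s(w)`) FIXED by every element of `Π_𝕂 = Aut(ρ_w^𝕂 ⋙ F)` — because `s` defines a morphism from
  the unit object of `B(𝒢_𝕂)` (one-point fibre) to the restriction of `coveringObj ψ`;
* `autApp_eq_of_sections`: if every vertex of `𝔾′` over `w` is the value of such a section, `Π_𝕂`
  acts trivially on the whole fibre;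
* `autApp_eq_cyclicCover`: the case of the cyclic covering `𝔾_M → 𝔾` twisted along `b₀`, over a
  sub-semi-graph `𝕂` not containing the edge of `b₀` (level sections, `CyclicCovering.lean`).

Proof-only (the unit object and the section morphism are built inside the proof), no definitions.
-/

namespace Literature.AnabelianGeometry.SemiGraphs

namespace SemiGraphOfAnabelioids

open CategoryTheory CategoryTheory.Limits CategoryTheory.PreGaloisCategory
open Literature.AnabelianGeometry.Anabelioids

universe v₁ u₁ u w

variable (𝒢 : SemiGraphOfAnabelioids.{v₁, u₁, u}) {G' : SemiGraph.{u}} {ψ : G' ⟶ 𝒢.graph}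
variable [∀ v, Finite (ψ.VertexFiber v)] [∀ e, Finite (ψ.EdgeFiber e)]
  (hψ : SemiGraph.IsExcision ψ) (hG' : G'.IsGraph)

/-- **A section over `𝕂` gives a `Π_𝕂`-fixed point of the fibre** ([SemiAnbd] p. 29, "trivial over
`𝕂`"): for a section `s` of `ψ` over `𝕂` (`s ≫ ψ = ι_𝕂`), a vertex `w` of `𝕂` and a basepoint `F`
of `𝒢_w`, every `τ ∈ Π_𝕂 = Aut(ρ_w^𝕂 ⋙ F)` fixes the fibre point of the sheet `s(w)` of
`coveringObj ψ`. [cite: MochizukiSemiAnbd2006, Prop. 2.6 p.29] -/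
theorem autApp_map_ι_eq_of_section (K : 𝒢.graph.Subgraph) (s : K.toSemiGraph ⟶ G')
    (hs : s ≫ ψ = K.ι) (w : K.toSemiGraph.Vertex) (F : 𝒢.V w.1 ⥤ FintypeCat.{w}) [FiberFunctor F]
    (τ : Aut ((𝒢.restrict K).ρ w ⋙ F)) (t : F.obj (⊤_ (𝒢.V w.1))) :
    τ.hom.app ((𝒢.restrictFunctor K).obj (𝒢.coveringObj hψ hG'))
        (F.map (Sigma.ι (fun _ : ψ.VertexFiber w.1 => ⊤_ (𝒢.V w.1))
          ⟨s.vertexMap w, congrArg (fun φ : K.toSemiGraph ⟶ 𝒢.graph => φ.vertexMap w) hs⟩) t) =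
      F.map (Sigma.ι (fun _ : ψ.VertexFiber w.1 => ⊤_ (𝒢.V w.1))
        ⟨s.vertexMap w, congrArg (fun φ : K.toSemiGraph ⟶ 𝒢.graph => φ.vertexMap w) hs⟩) t := by
  -- the sheets picked out by the section
  have hsV : ∀ u : K.toSemiGraph.Vertex, ψ.vertexMap (s.vertexMap u) = u.1 := fun u =>
    congrArg (fun φ : K.toSemiGraph ⟶ 𝒢.graph => φ.vertexMap u) hs
  have hsE : ∀ e : K.toSemiGraph.Edge, ψ.edgeMap (s.edgeMap e) = e.1 := fun e =>
    congrArg (fun φ : K.toSemiGraph ⟶ 𝒢.graph => φ.edgeMap e) hs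
  have hsB : ∀ b : K.toSemiGraph.Branch, ψ.branchMap (s.branchMap b) = b.1 := fun b =>
    congrArg (fun φ : K.toSemiGraph ⟶ 𝒢.graph => φ.branchMap b) hs
  -- the unit object `U` of `B(𝒢_𝕂)` (all constituents `1`, gluing by `b^* 1 ≅ 1`)
  let U : (𝒢.restrict K).BObj :=
    { S := fun u => ⊤_ (𝒢.V u.1)
      T := fun e => ⊤_ (𝒢.E e.1)
      ψ := fun b u h => PreservesTerminal.iso (𝒢.pull b.1 u.1 (K.ι.abuts_branchMap b u h)).pullback }
  -- the section morphism `U ⟶ (coveringObj ψ)|_𝕂`: the sheet `s(u)` over `u`, `s(e)` over `e`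
  let sec : U ⟶ (𝒢.restrictFunctor K).obj (𝒢.coveringObj hψ hG') :=
    { fS := fun u => Sigma.ι (fun _ : ψ.VertexFiber u.1 => ⊤_ (𝒢.V u.1)) ⟨s.vertexMap u, hsV u⟩
      fT := fun e => Sigma.ι (fun _ : ψ.EdgeFiber e.1 => ⊤_ (𝒢.E e.1)) ⟨s.edgeMap e, hsE e⟩
      comm := fun b u h => by
        have h₁ : 𝒢.graph.abuts b.1 = some u.1 := K.ι.abuts_branchMap b u h
        -- the branch bijection carries the sheet `s(u)` to the sheet `s(e)`, `e` the edge of `b`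
        have hfib : SemiGraph.Hom.fiberEquivOfBranch hψ hG' b.1 u.1 h₁ ⟨s.vertexMap u, hsV u⟩ =
            ⟨s.edgeMap (K.toSemiGraph.edgeOf b), hsE _⟩ := by
          apply Subtype.ext
          rw [SemiGraph.Hom.fiberEquivOfBranch_apply_val, ← SemiGraph.Hom.eq_branchLift hψ b.1 u.1
            h₁ ⟨s.vertexMap u, hsV u⟩ (s.branchMap b) (s.abuts_branchMap b u h) (hsB b)]
          exact s.edgeOf_branchMap b
        change (𝒢.pull b.1 u.1 h₁).pullback.map
            (Sigma.ι (fun _ : ψ.VertexFiber u.1 => ⊤_ (𝒢.V u.1)) ⟨s.vertexMap u, hsV u⟩) ≫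
            (𝒢.coveringGluing hψ hG' b.1 u.1 h₁).hom =
          (PreservesTerminal.iso (𝒢.pull b.1 u.1 h₁).pullback).hom ≫
            Sigma.ι (fun _ : ψ.EdgeFiber (𝒢.graph.edgeOf b.1) => ⊤_ (𝒢.E (𝒢.graph.edgeOf b.1)))
              ⟨s.edgeMap (K.toSemiGraph.edgeOf b), hsE _⟩
        rw [𝒢.map_ι_comp_coveringGluing_hom hψ hG' b.1 u.1 h₁, hfib] }
  -- `Π_𝕂` fixes the image of the one-point fibre of `U` (naturality of `τ` at `sec`)
  haveI : Subsingleton (((𝒢.restrict K).ρ w ⋙ F).obj U) := subsingleton_fiber_terminal F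
  exact app_map_eq_of_subsingleton ((𝒢.restrict K).ρ w ⋙ F) τ sec t

/-- **`Π_𝕂` acts trivially on the fibre of a covering with sections through every point over
`𝕂`.** [cite: MochizukiSemiAnbd2006, Prop. 2.6 p.29] -/
theorem autApp_eq_of_sections (K : 𝒢.graph.Subgraph) (w : K.toSemiGraph.Vertex)
    (hsec : ∀ v' : ψ.VertexFiber w.1, ∃ s : K.toSemiGraph ⟶ G', s ≫ ψ = K.ι ∧ s.vertexMap w = v'.1)
    (F : 𝒢.V w.1 ⥤ FintypeCat.{w}) [FiberFunctor F] (τ : Aut ((𝒢.restrict K).ρ w ⋙ F))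
    (y : F.obj ((𝒢.coveringObj hψ hG').S w.1)) :
    τ.hom.app ((𝒢.restrictFunctor K).obj (𝒢.coveringObj hψ hG')) y = y := by
  obtain ⟨t⟩ := (nonempty_equiv_fiber_terminal_punit F).map fun e => e.symm PUnit.unit
  obtain ⟨v', rfl⟩ := TrivialObj.exists_eq_map_ι F t y
  obtain ⟨s, hs, hsv⟩ := hsec v'
  obtain rfl : (⟨s.vertexMap w, congrArg (fun φ : K.toSemiGraph ⟶ 𝒢.graph => φ.vertexMap w) hs⟩ :
      ψ.VertexFiber w.1) = v' := Subtype.ext hsv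
  exact 𝒢.autApp_map_ι_eq_of_section hψ hG' K s hs w F τ t

/-- **The cyclic covering is trivial over `𝕂`** ([SemiAnbd] p. 29): for the degree-`M` cyclic
graph-covering `𝔾_M → 𝔾` twisted along the branch `b₀`, and a sub-semi-graph `𝕂` not containing
the edge of `b₀`, `Π_𝕂` acts trivially on the fibre of `coveringObj` at every vertex of `𝕂` (every
vertex `(v, i)` over `𝕂` is the value of the level section `i`). [cite: MochizukiSemiAnbd2006, Prop. 2.6 p.29] -/
theorem autApp_eq_cyclicCover (hG : 𝒢.graph.IsGraph) (b₀ : 𝒢.graph.Branch) (M : ℕ) [NeZero M]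
    [∀ v, Finite ((𝒢.graph.cyclicCoverHom b₀ M).VertexFiber v)]
    [∀ e, Finite ((𝒢.graph.cyclicCoverHom b₀ M).EdgeFiber e)]
    (K : 𝒢.graph.Subgraph) (hK : 𝒢.graph.edgeOf b₀ ∉ K.edges) (w : K.toSemiGraph.Vertex)
    (F : 𝒢.V w.1 ⥤ FintypeCat.{w}) [FiberFunctor F] (τ : Aut ((𝒢.restrict K).ρ w ⋙ F))
    (y : F.obj ((𝒢.coveringObj (𝒢.graph.cyclicCoverHom_isExcision b₀ M)
      (𝒢.graph.cyclicCover_isGraph b₀ M hG)).S w.1)) :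
    τ.hom.app ((𝒢.restrictFunctor K).obj (𝒢.coveringObj (𝒢.graph.cyclicCoverHom_isExcision b₀ M)
      (𝒢.graph.cyclicCover_isGraph b₀ M hG))) y = y := by
  refine 𝒢.autApp_eq_of_sections _ _ K w (fun v' => ?_) F τ y
  -- the level section through `v′ = (w, i)`
  have h2 : v'.1.1 = w.1 := v'.2
  have hx : v'.1.1 ∈ K.verts := by rw [h2]; exact w.2
  obtain ⟨i, hi, -⟩ := SemiGraph.levelSection_vertexMap_surjective M K hK v'.1 hx
  refine ⟨SemiGraph.levelSection M K hK i, SemiGraph.levelSection_comp M K hK i, ?_⟩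
  have hw : (⟨v'.1.1, hx⟩ : K.toSemiGraph.Vertex) = w := Subtype.ext h2
  exact (congrArg (SemiGraph.levelSection M K hK i).vertexMap hw).symm.trans hi

end SemiGraphOfAnabelioids

end Literature.AnabelianGeometry.SemiGraphs
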